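import Literature.NumberTheory.EllipticCurves.CMNewformOfHeckeCharacterProofs
import Mathlib.RingTheory.DedekindDomain.Factorization
import HarnessLib

/-!
# The CM newform of a Hecke character: the Hecke recursion of `a_n = ∑_{N𝔞 = n} ψ(𝔞)` (proofs only)

Second sibling proof file of `Literature.NumberTheory.EllipticCurves.CMNewformOfHeckeCharacter`
(named fact `Ribet1977_cmNewform_of_heckeCharacter`; Ribet, LNM 601 (1977), §3).  Theorems only —
no definition, no named fact (D-0026).

Ribet's Theorem (3.4), second sentence: "If `p ∤ DM`, then `g ∣ T_p = a_p g`" for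
`g = ∑_𝔞 ψ(𝔞) q^{N𝔞}`, `a_p = ∑_{N𝔞 = p} ψ(𝔞)` — equivalently (Shimura 1971, proof of Lemma 3:
"`L(s, λ) = ∏_p (1 - a_p p^{-s} + ε(p) p^{k-1-2s})⁻¹` … therefore `f_λ` must be a common
eigen-function of all Hecke operators", Hecke 1937, Satz 42) the Dirichlet coefficients
`A(n) = ∑_{N𝔞 = n} ψ(𝔞)` of `L(s, ψ) = ∑_𝔞 ψ(𝔞) N𝔞^{-s}` satisfy the `GL₂` **Hecke recursion** at every
rational prime `p` unramified in `K` and prime to the conductor: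

  `A(p) A(n) = A(pn) + c_p A(n/p)` (`p ∣ n`),  `A(p) A(n) = A(pn)` (`p ∤ n`),

with `c_p = ψ((p))` if `p` splits and `c_p = -ψ((p))` if `p` is inert — i.e. `c_p = ε(p) p^{k-1}`,
which with the `q`-expansion of `T_p` on `S_k(Γ₁(N))` (tree `qExpansion_coeff_heckeT_gamma1_holds`:
`a_n(T_p g) = a_{pn}(g) + ε(p) p^{k-1} a_{n/p}(g)` for `g ∈ S_k(N, ε)`) is exactly `T_p g = A(p) g`.
This file proves the recursion as pure arithmetic of the Dedekind domain `𝓞 K`, for any function `g`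
on the ideals of `𝓞 K` which is completely multiplicative on nonzero ideals with `g(1) = 1` (e.g. the
ideal character `ψ̃ = idealPow` of `ψ`, or its restriction `rayClassCoeff 𝔣 ψ̃` to the ideals prime
to `𝔣`), writing `A(n) = ∑ᶠ_{N𝔞 = n} g(𝔞)`:

* `finsum_absNorm_eq_mul_of_coprime` — `A(mn) = A(m) A(n)` for coprime `m, n ≥ 1` (the bijection
  `𝔞 ↦ (𝔞 + (m), 𝔞 + (n))` of the tree's `IdealNormCount.equivProdOfCoprime`);
* `finsum_absNorm_eq_prime_pow_of_pair` — at a split `p = 𝔭𝔭̄`: the ideals of norm `p^e` are the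
  `𝔭^i 𝔭̄^{e-i}` and `A(p^e) = ∑_{i ≤ e} g(𝔭)^i g(𝔭̄)^{e-i}`, whence
  `A(p^{e+2}) = A(p) A(p^{e+1}) - g(𝔭)g(𝔭̄) A(p^e)` (`finsum_absNorm_eq_prime_pow_rec_of_pair`);
* `finsum_absNorm_eq_prime_pow_of_singleton` — at an inert `p`, `(p) = 𝔭`: the ideals of norm `p^e`
  are the `𝔭^i` with `2i = e`, so `A(p^{e+2}) = g(𝔭) A(p^e)` and `A(p) = 0`;
* `finsum_absNorm_eq_hecke_of_not_dvd`, `finsum_absNorm_eq_hecke_of_pair`, `…_of_singleton` —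
  the Hecke recursion above for all `n ≥ 1`;
* `finsum_absNorm_eq_rayClassCoeff_hecke_of_pair`, `…_of_singleton` — the same for the actual CM
  coefficients `a_n = ∑_{N𝔞 = n, (𝔞,𝔪)=1} ψ̃(𝔞)` (`rayClassCoeff 𝔪 ψ̃`), with `c_p = ±ψ̃((p))`
  (`idealPow` of `(p)`), matching the Ribet-form Euler-factor lemmas of the sibling file.

## References

* K. A. Ribet, *Galois representations attached to eigenforms with Nebentypus*, LNM 601 (1977),
  §3, Thm. (3.4) (p. 35). [Ribet1977Nebentypus]
* G. Shimura, *On elliptic curves with complex multiplication as factors of the Jacobians of modular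
  function fields*, Nagoya Math. J. 43 (1971), proof of Lemma 3 (p. 204).
* E. Hecke, *Über Modulfunktionen und die Dirichletschen Reihen mit Eulerscher Produktentwicklung*
  II, Math. Ann. 114 (1937), Satz 42. [Hecke1937]
-/

noncomputable section

open scoped NumberField
open NumberField IsDedekindDomain
open Literature.NumberTheory.GaloisRepresentations

namespace Literature.NumberTheory.EllipticCurves.ModularForms

variable {K : Type} [Field K] [NumberField K] {R : Type*} [CommRing R]

/-! ### The norm sums `A(n) = ∑_{N𝔞 = n} g(𝔞)` as finite sums -/

section NormSum

/-- The sum over the ideals of norm `n` as a `Fintype` sum over the (finite) subtype. [folklore] -/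
theorem finsum_absNorm_eq_eq_sum (g : Ideal (𝓞 K) → R) (n : ℕ)
    [Fintype {I : Ideal (𝓞 K) // Ideal.absNorm I = n}] :
    ∑ᶠ I ∈ {I : Ideal (𝓞 K) | Ideal.absNorm I = n}, g I =
      ∑ I : {I : Ideal (𝓞 K) // Ideal.absNorm I = n}, g I.1 := by
  rw [finsum_mem_eq_finite_toFinset_sum g (Ideal.finite_setOf_absNorm_eq n)]
  exact Finset.sum_subtype _ (fun I => by simp) _

/-- `A(1) = g(1)`: only the unit ideal has norm `1`. [folklore] -/
theorem finsum_absNorm_eq_one (g : Ideal (𝓞 K) → R) :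
    ∑ᶠ I ∈ {I : Ideal (𝓞 K) | Ideal.absNorm I = 1}, g I = g ⊤ := by
  have h : {I : Ideal (𝓞 K) | Ideal.absNorm I = 1} = {⊤} := by
    ext I
    simp [Ideal.absNorm_eq_one_iff]
  rw [h, finsum_mem_singleton]

/-- **`A(mn) = A(m) A(n)` for coprime `m, n ≥ 1`** when `g` is multiplicative on ideals of coprime
norms: the bijection `{𝔞 : N𝔞 = mn} ≃ {N = m} × {N = n}`, `𝔞 ↦ (𝔞 + (m), 𝔞 + (n))`, `(𝔟, 𝔠) ↦ 𝔟𝔠`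
(tree `IdealNormCount.equivProdOfCoprime`). [folklore] -/
theorem finsum_absNorm_eq_mul_of_coprime (g : Ideal (𝓞 K) → R)
    (hg : ∀ A B : Ideal (𝓞 K), (Ideal.absNorm A).Coprime (Ideal.absNorm B) → g (A * B) = g A * g B)
    {m n : ℕ} (hm : 0 < m) (hn : 0 < n) (h : m.Coprime n) :
    ∑ᶠ I ∈ {I : Ideal (𝓞 K) | Ideal.absNorm I = m * n}, g I =
      (∑ᶠ I ∈ {I : Ideal (𝓞 K) | Ideal.absNorm I = m}, g I) *
        ∑ᶠ I ∈ {I : Ideal (𝓞 K) | Ideal.absNorm I = n}, g I := by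
  classical
  haveI : ∀ k : ℕ, Fintype {I : Ideal (𝓞 K) // Ideal.absNorm I = k} := fun k => Fintype.ofFinite _
  rw [finsum_absNorm_eq_eq_sum, finsum_absNorm_eq_eq_sum, finsum_absNorm_eq_eq_sum,
    Fintype.sum_equiv (Literature.NumberTheory.LFunctions.IdealNormCount.equivProdOfCoprime K hm hn h)
      (fun I => g I.1) (fun AB => g AB.1.1 * g AB.2.1) ?_,
    Fintype.sum_prod_type, Finset.sum_mul_sum]
  intro I
  set e := Literature.NumberTheory.LFunctions.IdealNormCount.equivProdOfCoprime K hm hn h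
  have hI : I = e.symm (e I) := (e.symm_apply_apply I).symm
  conv_lhs => rw [hI]
  change g ((e I).1.1 * (e I).2.1) = _
  exact hg _ _ (by rw [(e I).1.2, (e I).2.2]; exact h)

/-- Complete multiplicativity on nonzero ideals with `g(1) = 1` implies multiplicativity on ideals
of coprime norms (the only ideal of norm `0` is `0`, and `Coprime 0 k` forces `k = 1`). [folklore] -/
theorem map_mul_of_coprime_absNorm (g : Ideal (𝓞 K) → R)
    (hg : ∀ A B : Ideal (𝓞 K), A ≠ ⊥ → B ≠ ⊥ → g (A * B) = g A * g B) (hg1 : g ⊤ = 1)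
    (A B : Ideal (𝓞 K)) (h : (Ideal.absNorm A).Coprime (Ideal.absNorm B)) :
    g (A * B) = g A * g B := by
  by_cases hA : A = ⊥
  · subst hA
    rw [Ideal.absNorm_bot, Nat.coprime_zero_left, Ideal.absNorm_eq_one_iff] at h
    rw [h, Ideal.mul_top, hg1, mul_one]
  by_cases hB : B = ⊥
  · subst hB
    rw [Ideal.absNorm_bot, Nat.coprime_zero_right, Ideal.absNorm_eq_one_iff] at h
    rw [h, Ideal.top_mul, hg1, one_mul]
  exact hg A B hA hB

omit [NumberField K] in
/-- `g(𝔞ⁿ) = g(𝔞)ⁿ` for a completely multiplicative `g` with `g(1) = 1` and `𝔞 ≠ 0`. [folklore] -/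
theorem map_pow_of_map_mul (g : Ideal (𝓞 K) → R)
    (hg : ∀ A B : Ideal (𝓞 K), A ≠ ⊥ → B ≠ ⊥ → g (A * B) = g A * g B) (hg1 : g ⊤ = 1)
    {A : Ideal (𝓞 K)} (hA : A ≠ ⊥) (n : ℕ) : g (A ^ n) = g A ^ n := by
  induction n with
  | zero => rw [pow_zero, pow_zero, Ideal.one_eq_top, hg1]
  | succ n ih => rw [pow_succ, hg _ _ (pow_ne_zero n hA) hA, ih, pow_succ]

end NormSum

/-! ### Ideals of `p`-power norm at an unramified prime -/

section PrimePower

/-- **A prime dividing an ideal of `p`-power norm lies above `p`.** [folklore] -/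
theorem asIdeal_under_eq_of_dvd_of_absNorm_eq_pow (v : HeightOneSpectrum (𝓞 ℚ)) {I : Ideal (𝓞 K)}
    {e : ℕ} (hI : Ideal.absNorm I = Rat.HeightOneSpectrum.natGenerator v ^ e)
    {w : HeightOneSpectrum (𝓞 K)} (hw : w.asIdeal ∣ I) : w.asIdeal.under (𝓞 ℚ) = v.asIdeal := by
  set q := Rat.HeightOneSpectrum.natGenerator (w.under (𝓞 ℚ)) with hq
  have hqp : q.Prime := Rat.HeightOneSpectrum.prime_natGenerator _
  have hpp : (Rat.HeightOneSpectrum.natGenerator v).Prime := Rat.HeightOneSpectrum.prime_natGenerator v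
  have hN : Ideal.absNorm w.asIdeal = q ^ w.asIdeal.inertiaDeg (𝓞 ℚ) :=
    absNorm_asIdeal_eq_natGenerator_pow w
  have hf : w.asIdeal.inertiaDeg (𝓞 ℚ) ≠ 0 := by
    intro h0
    rw [h0, pow_zero, Ideal.absNorm_eq_one_iff] at hN
    exact w.isPrime.ne_top hN
  have hdvd : q ∣ Rat.HeightOneSpectrum.natGenerator v ^ e := by
    have h1 : Ideal.absNorm w.asIdeal ∣ Ideal.absNorm I :=
      Ideal.absNorm_dvd_absNorm_of_le (Ideal.le_of_dvd hw)
    rw [hN, hI] at h1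
    exact (dvd_pow_self q hf).trans h1
  have heq : q = Rat.HeightOneSpectrum.natGenerator v :=
    (Nat.prime_dvd_prime_iff_eq hqp hpp).mp (hqp.dvd_of_dvd_pow hdvd)
  have hwv : w.under (𝓞 ℚ) = v :=
    (Rat.HeightOneSpectrum.primesEquiv (R := 𝓞 ℚ)).injective (Subtype.ext heq)
  rw [← hwv, HeightOneSpectrum.under_asIdeal]

/-- An ideal of `p`-power norm is nonzero. [folklore] -/
theorem ne_bot_of_absNorm_eq_pow (v : HeightOneSpectrum (𝓞 ℚ)) {I : Ideal (𝓞 K)} {e : ℕ}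
    (hI : Ideal.absNorm I = Rat.HeightOneSpectrum.natGenerator v ^ e) : I ≠ ⊥ := by
  rintro rfl
  rw [Ideal.absNorm_bot] at hI
  exact pow_ne_zero e (Rat.HeightOneSpectrum.prime_natGenerator v).ne_zero hI.symm

/-- **Split `p`: an ideal of norm `p^e` is `𝔭^a 𝔭̄^b`** with `a, b` its multiplicities at the two
places above `p` (unique factorisation: every prime factor lies above `p`). [folklore] -/
theorem eq_pow_mul_pow_of_absNorm_eq_pow (v : HeightOneSpectrum (𝓞 ℚ)) {w₁ w₂ : HeightOneSpectrum (𝓞 K)}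
    (hne : w₁ ≠ w₂)
    (hS : {w : HeightOneSpectrum (𝓞 K) | w.asIdeal.under (𝓞 ℚ) = v.asIdeal} = {w₁, w₂})
    {I : Ideal (𝓞 K)} {e : ℕ} (hI : Ideal.absNorm I = Rat.HeightOneSpectrum.natGenerator v ^ e) :
    I = w₁.asIdeal ^ (Associates.mk w₁.asIdeal).count (Associates.mk I).factors *
        w₂.asIdeal ^ (Associates.mk w₂.asIdeal).count (Associates.mk I).factors := by
  classical
  have hI0 : I ≠ ⊥ := ne_bot_of_absNorm_eq_pow v hI
  have hfact := Ideal.finprod_heightOneSpectrum_factorization hI0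
  have hsupp : (Function.mulSupport fun w : HeightOneSpectrum (𝓞 K) => w.maxPowDividing I) ⊆
      ↑({w₁, w₂} : Finset (HeightOneSpectrum (𝓞 K))) := by
    intro w hw
    rw [Function.mem_mulSupport] at hw
    have hc : (Associates.mk w.asIdeal).count (Associates.mk I).factors ≠ 0 := by
      intro h0
      exact hw (by rw [HeightOneSpectrum.maxPowDividing, h0, pow_zero])
    have hdvd : w.asIdeal ∣ I := (Associates.count_ne_zero_iff_dvd hI0 w.irreducible).mp hc
    have hwv : w ∈ {w : HeightOneSpectrum (𝓞 K) | w.asIdeal.under (𝓞 ℚ) = v.asIdeal} :=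
      asIdeal_under_eq_of_dvd_of_absNorm_eq_pow v hI hdvd
    rw [hS] at hwv
    simpa using hwv
  rw [finprod_eq_prod_of_mulSupport_subset _ hsupp, Finset.prod_pair hne] at hfact
  exact hfact.symm

/-- The multiplicity of `𝔭_{w₁}` in `𝔭_{w₁}^i 𝔭_{w₂}^j` is `i` (`w₁ ≠ w₂`). [folklore] -/
theorem count_pow_mul_pow {w₁ w₂ : HeightOneSpectrum (𝓞 K)} (hne : w₁ ≠ w₂) (i j : ℕ) :
    (Associates.mk w₁.asIdeal).count
        (Associates.mk (w₁.asIdeal ^ i * w₂.asIdeal ^ j)).factors = i := by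
  classical
  have h₁ := w₁.associates_irreducible
  have h₂ := w₂.associates_irreducible
  have hne' : Associates.mk w₁.asIdeal ≠ Associates.mk w₂.asIdeal := by
    intro h
    rw [Associates.mk_eq_mk_iff_associated, associated_iff_eq] at h
    exact hne (HeightOneSpectrum.ext h)
  have ha : Associates.mk (w₁.asIdeal ^ i) ≠ 0 := Associates.mk_ne_zero.mpr (pow_ne_zero _ w₁.ne_bot)
  have hb : Associates.mk (w₂.asIdeal ^ j) ≠ 0 := Associates.mk_ne_zero.mpr (pow_ne_zero _ w₂.ne_bot)
  have ha' : Associates.mk w₁.asIdeal ≠ 0 := Associates.mk_ne_zero.mpr w₁.ne_bot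
  have hb' : Associates.mk w₂.asIdeal ≠ 0 := Associates.mk_ne_zero.mpr w₂.ne_bot
  rw [← Associates.mk_mul_mk, Associates.count_mul ha hb h₁, Associates.mk_pow, Associates.mk_pow,
    Associates.count_pow ha' h₁, Associates.count_pow hb' h₁, Associates.count_self h₁,
    Associates.count_eq_zero_of_ne h₁ h₂ hne', mul_one, mul_zero, add_zero]

/-- **Split `p`: the ideals of norm `p^e` are exactly the `𝔭^i 𝔭̄^{e-i}`, `0 ≤ i ≤ e`.** [folklore] -/
theorem setOf_absNorm_eq_pow_of_pair (v : HeightOneSpectrum (𝓞 ℚ)) {w₁ w₂ : HeightOneSpectrum (𝓞 K)}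
    (hne : w₁ ≠ w₂)
    (hS : {w : HeightOneSpectrum (𝓞 K) | w.asIdeal.under (𝓞 ℚ) = v.asIdeal} = {w₁, w₂})
    (h₁ : w₁.asIdeal.inertiaDeg (𝓞 ℚ) = 1) (h₂ : w₂.asIdeal.inertiaDeg (𝓞 ℚ) = 1) (e : ℕ) :
    {I : Ideal (𝓞 K) | Ideal.absNorm I = Rat.HeightOneSpectrum.natGenerator v ^ e} =
      (fun i : ℕ => w₁.asIdeal ^ i * w₂.asIdeal ^ (e - i)) '' ↑(Finset.range (e + 1)) := by
  set p := Rat.HeightOneSpectrum.natGenerator v with hp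
  have hpp : p.Prime := Rat.HeightOneSpectrum.prime_natGenerator v
  have hm₁ : w₁.asIdeal.under (𝓞 ℚ) = v.asIdeal := by
    have : w₁ ∈ {w : HeightOneSpectrum (𝓞 K) | w.asIdeal.under (𝓞 ℚ) = v.asIdeal} := by
      rw [hS]; exact Set.mem_insert _ _
    exact this
  have hm₂ : w₂.asIdeal.under (𝓞 ℚ) = v.asIdeal := by
    have : w₂ ∈ {w : HeightOneSpectrum (𝓞 K) | w.asIdeal.under (𝓞 ℚ) = v.asIdeal} := by
      rw [hS]; exact Set.mem_insert_of_mem _ rfl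
    exact this
  have hn₁ : Ideal.absNorm w₁.asIdeal = p := (absNorm_eq_natGenerator_iff v _).mpr ⟨w₁, rfl, hm₁, h₁⟩
  have hn₂ : Ideal.absNorm w₂.asIdeal = p := (absNorm_eq_natGenerator_iff v _).mpr ⟨w₂, rfl, hm₂, h₂⟩
  ext I
  simp only [Set.mem_setOf_eq, Set.mem_image, Finset.coe_range, Set.mem_Iio]
  constructor
  · intro hI
    set a := (Associates.mk w₁.asIdeal).count (Associates.mk I).factors with ha
    set b := (Associates.mk w₂.asIdeal).count (Associates.mk I).factors with hb
    have hfac : I = w₁.asIdeal ^ a * w₂.asIdeal ^ b := eq_pow_mul_pow_of_absNorm_eq_pow v hne hS hI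
    have hab : a + b = e := by
      have h := hI
      rw [hfac, map_mul, map_pow, map_pow, hn₁, hn₂, ← pow_add] at h
      exact Nat.pow_right_injective hpp.two_le h
    refine ⟨a, by omega, ?_⟩
    rw [show e - a = b by omega]
    exact hfac.symm
  · rintro ⟨i, hi, rfl⟩
    rw [map_mul, map_pow, map_pow, hn₁, hn₂, ← pow_add]
    congr 1
    omega

/-- **`A(p^e) = ∑_{i ≤ e} g(𝔭)^i g(𝔭̄)^{e-i}` at a split prime** for a completely multiplicative `g`
with `g(1) = 1`. [folklore] -/
theorem finsum_absNorm_eq_prime_pow_of_pair (g : Ideal (𝓞 K) → R)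
    (hg : ∀ A B : Ideal (𝓞 K), A ≠ ⊥ → B ≠ ⊥ → g (A * B) = g A * g B) (hg1 : g ⊤ = 1)
    (v : HeightOneSpectrum (𝓞 ℚ)) {w₁ w₂ : HeightOneSpectrum (𝓞 K)} (hne : w₁ ≠ w₂)
    (hS : {w : HeightOneSpectrum (𝓞 K) | w.asIdeal.under (𝓞 ℚ) = v.asIdeal} = {w₁, w₂})
    (h₁ : w₁.asIdeal.inertiaDeg (𝓞 ℚ) = 1) (h₂ : w₂.asIdeal.inertiaDeg (𝓞 ℚ) = 1) (e : ℕ) :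
    ∑ᶠ I ∈ {I : Ideal (𝓞 K) | Ideal.absNorm I = Rat.HeightOneSpectrum.natGenerator v ^ e}, g I =
      ∑ i ∈ Finset.range (e + 1), g w₁.asIdeal ^ i * g w₂.asIdeal ^ (e - i) := by
  have hinj : Set.InjOn (fun i : ℕ => w₁.asIdeal ^ i * w₂.asIdeal ^ (e - i))
      ↑(Finset.range (e + 1)) := by
    intro i _ j _ hij
    have h := congrArg (fun I : Ideal (𝓞 K) =>
      (Associates.mk w₁.asIdeal).count (Associates.mk I).factors) hij
    simpa only [count_pow_mul_pow hne] using h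
  rw [setOf_absNorm_eq_pow_of_pair v hne hS h₁ h₂ e, finsum_mem_image hinj, finsum_mem_coe_finset]
  refine Finset.sum_congr rfl fun i _ => ?_
  rw [hg _ _ (pow_ne_zero _ w₁.ne_bot) (pow_ne_zero _ w₂.ne_bot),
    map_pow_of_map_mul g hg hg1 w₁.ne_bot, map_pow_of_map_mul g hg hg1 w₂.ne_bot]

/-- The two-variable complete homogeneous sums `T_e(α, β) = ∑_{i ≤ e} αⁱ β^{e-i}` satisfy
`T_{e+1} = α^{e+1} + β T_e`. [folklore] -/
theorem sum_range_pow_mul_pow_succ (α β : R) (e : ℕ) :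
    ∑ i ∈ Finset.range (e + 2), α ^ i * β ^ (e + 1 - i) =
      α ^ (e + 1) + β * ∑ i ∈ Finset.range (e + 1), α ^ i * β ^ (e - i) := by
  rw [Finset.sum_range_succ, Nat.sub_self, pow_zero, mul_one, add_comm, Finset.mul_sum]
  congr 1
  refine Finset.sum_congr rfl fun i hi => ?_
  rw [Finset.mem_range] at hi
  rw [show e + 1 - i = (e - i) + 1 by omega, pow_succ]
  ring

/-- … and hence the linear recursion `T_{e+2} = (α + β) T_{e+1} - αβ T_e`. [folklore] -/
theorem sum_range_pow_mul_pow_rec (α β : R) (e : ℕ) :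
    ∑ i ∈ Finset.range (e + 3), α ^ i * β ^ (e + 2 - i) =
      (α + β) * (∑ i ∈ Finset.range (e + 2), α ^ i * β ^ (e + 1 - i)) -
        α * β * ∑ i ∈ Finset.range (e + 1), α ^ i * β ^ (e - i) := by
  rw [show e + 3 = (e + 1) + 2 by ring, show e + 2 = (e + 1) + 1 by ring,
    sum_range_pow_mul_pow_succ α β (e + 1), sum_range_pow_mul_pow_succ α β e]
  ring

/-- **The recursion `A(p^{e+2}) = A(p) A(p^{e+1}) - g(𝔭) g(𝔭̄) A(p^e)` at a split prime.** [folklore] -/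
theorem finsum_absNorm_eq_prime_pow_rec_of_pair (g : Ideal (𝓞 K) → R)
    (hg : ∀ A B : Ideal (𝓞 K), A ≠ ⊥ → B ≠ ⊥ → g (A * B) = g A * g B) (hg1 : g ⊤ = 1)
    (v : HeightOneSpectrum (𝓞 ℚ)) {w₁ w₂ : HeightOneSpectrum (𝓞 K)} (hne : w₁ ≠ w₂)
    (hS : {w : HeightOneSpectrum (𝓞 K) | w.asIdeal.under (𝓞 ℚ) = v.asIdeal} = {w₁, w₂})
    (h₁ : w₁.asIdeal.inertiaDeg (𝓞 ℚ) = 1) (h₂ : w₂.asIdeal.inertiaDeg (𝓞 ℚ) = 1) (e : ℕ) :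
    ∑ᶠ I ∈ {I : Ideal (𝓞 K) | Ideal.absNorm I = Rat.HeightOneSpectrum.natGenerator v ^ (e + 2)}, g I =
      (∑ᶠ I ∈ {I : Ideal (𝓞 K) | Ideal.absNorm I = Rat.HeightOneSpectrum.natGenerator v}, g I) *
          (∑ᶠ I ∈ {I : Ideal (𝓞 K) | Ideal.absNorm I = Rat.HeightOneSpectrum.natGenerator v ^ (e + 1)},
            g I) -
        g w₁.asIdeal * g w₂.asIdeal *
          ∑ᶠ I ∈ {I : Ideal (𝓞 K) | Ideal.absNorm I = Rat.HeightOneSpectrum.natGenerator v ^ e}, g I := by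
  rw [finsum_absNorm_eq_prime_pow_of_pair g hg hg1 v hne hS h₁ h₂ (e + 2),
    finsum_absNorm_eq_prime_pow_of_pair g hg hg1 v hne hS h₁ h₂ (e + 1),
    finsum_absNorm_eq_prime_pow_of_pair g hg hg1 v hne hS h₁ h₂ e,
    finsum_mem_setOf_absNorm_eq_of_pair v hne hS h₁ h₂ g, sum_range_pow_mul_pow_rec]

/-- **Inert `p`: an ideal of norm `p^e` is a power of `𝔭 = (p)`.** [folklore] -/
theorem eq_pow_of_absNorm_eq_pow_of_singleton (v : HeightOneSpectrum (𝓞 ℚ)) {w : HeightOneSpectrum (𝓞 K)}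
    (hS : {w : HeightOneSpectrum (𝓞 K) | w.asIdeal.under (𝓞 ℚ) = v.asIdeal} = {w})
    {I : Ideal (𝓞 K)} {e : ℕ} (hI : Ideal.absNorm I = Rat.HeightOneSpectrum.natGenerator v ^ e) :
    I = w.asIdeal ^ (Associates.mk w.asIdeal).count (Associates.mk I).factors := by
  classical
  have hI0 : I ≠ ⊥ := ne_bot_of_absNorm_eq_pow v hI
  have hfact := Ideal.finprod_heightOneSpectrum_factorization hI0
  have hsupp : (Function.mulSupport fun w : HeightOneSpectrum (𝓞 K) => w.maxPowDividing I) ⊆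
      ↑({w} : Finset (HeightOneSpectrum (𝓞 K))) := by
    intro w' hw'
    rw [Function.mem_mulSupport] at hw'
    have hc : (Associates.mk w'.asIdeal).count (Associates.mk I).factors ≠ 0 := by
      intro h0
      exact hw' (by rw [HeightOneSpectrum.maxPowDividing, h0, pow_zero])
    have hdvd : w'.asIdeal ∣ I := (Associates.count_ne_zero_iff_dvd hI0 w'.irreducible).mp hc
    have hwv : w' ∈ {w : HeightOneSpectrum (𝓞 K) | w.asIdeal.under (𝓞 ℚ) = v.asIdeal} :=
      asIdeal_under_eq_of_dvd_of_absNorm_eq_pow v hI hdvd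
    rw [hS] at hwv
    simpa using hwv
  rw [finprod_eq_prod_of_mulSupport_subset _ hsupp, Finset.prod_singleton] at hfact
  exact hfact.symm

/-- **Inert `p`: the ideals of norm `p^{2a}` and `p^{2a+1}`** are `{𝔭^a}` and `∅` (`N𝔭 = p²`). [folklore] -/
theorem setOf_absNorm_eq_pow_of_singleton (v : HeightOneSpectrum (𝓞 ℚ)) {w : HeightOneSpectrum (𝓞 K)}
    (hS : {w : HeightOneSpectrum (𝓞 K) | w.asIdeal.under (𝓞 ℚ) = v.asIdeal} = {w})
    (hw : w.asIdeal.inertiaDeg (𝓞 ℚ) = 2) (a : ℕ) :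
    {I : Ideal (𝓞 K) | Ideal.absNorm I = Rat.HeightOneSpectrum.natGenerator v ^ (2 * a)} =
        {w.asIdeal ^ a} ∧
      {I : Ideal (𝓞 K) | Ideal.absNorm I = Rat.HeightOneSpectrum.natGenerator v ^ (2 * a + 1)} = ∅ := by
  set p := Rat.HeightOneSpectrum.natGenerator v with hp
  have hpp : p.Prime := Rat.HeightOneSpectrum.prime_natGenerator v
  have hm : w.asIdeal.under (𝓞 ℚ) = v.asIdeal := by
    have : w ∈ {w : HeightOneSpectrum (𝓞 K) | w.asIdeal.under (𝓞 ℚ) = v.asIdeal} := by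
      rw [hS]; exact Set.mem_singleton _
    exact this
  have hwv : w.under (𝓞 ℚ) = v :=
    HeightOneSpectrum.ext (by rw [HeightOneSpectrum.under_asIdeal]; exact hm)
  have hn : Ideal.absNorm w.asIdeal = p ^ 2 := by
    rw [absNorm_asIdeal_eq_natGenerator_pow, hwv, hw]
  -- the norm of `𝔭^c` is `p^{2c}`
  have hnc : ∀ c : ℕ, Ideal.absNorm (w.asIdeal ^ c) = p ^ (2 * c) := fun c => by
    rw [map_pow, hn, ← pow_mul]
  constructor
  · ext I
    simp only [Set.mem_setOf_eq, Set.mem_singleton_iff]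
    constructor
    · intro hI
      have hfac := eq_pow_of_absNorm_eq_pow_of_singleton v hS hI
      set c := (Associates.mk w.asIdeal).count (Associates.mk I).factors with hc
      have h := hI
      rw [hfac, hnc] at h
      have h2c : 2 * c = 2 * a := Nat.pow_right_injective hpp.two_le h
      rw [hfac, show c = a by omega]
    · rintro rfl
      exact hnc a
  · ext I
    simp only [Set.mem_setOf_eq, Set.mem_empty_iff_false, iff_false]
    intro hI
    have hfac := eq_pow_of_absNorm_eq_pow_of_singleton v hS hI
    set c := (Associates.mk w.asIdeal).count (Associates.mk I).factors with hc
    rw [hfac, hnc] at hI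
    have h2c : 2 * c = 2 * a + 1 := Nat.pow_right_injective hpp.two_le hI
    omega

/-- **`A(p^{2a}) = g(𝔭)^a` and `A(p^{2a+1}) = 0` at an inert prime** (`g` completely multiplicative,
`g(1) = 1`). [folklore] -/
theorem finsum_absNorm_eq_prime_pow_of_singleton (g : Ideal (𝓞 K) → R)
    (hg : ∀ A B : Ideal (𝓞 K), A ≠ ⊥ → B ≠ ⊥ → g (A * B) = g A * g B) (hg1 : g ⊤ = 1)
    (v : HeightOneSpectrum (𝓞 ℚ)) {w : HeightOneSpectrum (𝓞 K)}
    (hS : {w : HeightOneSpectrum (𝓞 K) | w.asIdeal.under (𝓞 ℚ) = v.asIdeal} = {w})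
    (hw : w.asIdeal.inertiaDeg (𝓞 ℚ) = 2) (a : ℕ) :
    ∑ᶠ I ∈ {I : Ideal (𝓞 K) | Ideal.absNorm I = Rat.HeightOneSpectrum.natGenerator v ^ (2 * a)}, g I =
        g w.asIdeal ^ a ∧
      ∑ᶠ I ∈ {I : Ideal (𝓞 K) | Ideal.absNorm I = Rat.HeightOneSpectrum.natGenerator v ^ (2 * a + 1)},
        g I = 0 := by
  obtain ⟨heven, hodd⟩ := setOf_absNorm_eq_pow_of_singleton v hS hw a
  constructor
  · rw [heven, finsum_mem_singleton, map_pow_of_map_mul g hg hg1 w.ne_bot]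
  · rw [hodd, finsum_mem_empty]

/-- **The recursion `A(p^{e+2}) = g(𝔭) A(p^e)` at an inert prime** (both sides vanish for odd `e`).
[folklore] -/
theorem finsum_absNorm_eq_prime_pow_rec_of_singleton (g : Ideal (𝓞 K) → R)
    (hg : ∀ A B : Ideal (𝓞 K), A ≠ ⊥ → B ≠ ⊥ → g (A * B) = g A * g B) (hg1 : g ⊤ = 1)
    (v : HeightOneSpectrum (𝓞 ℚ)) {w : HeightOneSpectrum (𝓞 K)}
    (hS : {w : HeightOneSpectrum (𝓞 K) | w.asIdeal.under (𝓞 ℚ) = v.asIdeal} = {w})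
    (hw : w.asIdeal.inertiaDeg (𝓞 ℚ) = 2) (e : ℕ) :
    ∑ᶠ I ∈ {I : Ideal (𝓞 K) | Ideal.absNorm I = Rat.HeightOneSpectrum.natGenerator v ^ (e + 2)}, g I =
      g w.asIdeal *
        ∑ᶠ I ∈ {I : Ideal (𝓞 K) | Ideal.absNorm I = Rat.HeightOneSpectrum.natGenerator v ^ e}, g I := by
  obtain ⟨a, rfl | rfl⟩ := Nat.even_or_odd' e
  · rw [show 2 * a + 2 = 2 * (a + 1) by ring, (finsum_absNorm_eq_prime_pow_of_singleton g hg hg1 v hS hw (a + 1)).1,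
      (finsum_absNorm_eq_prime_pow_of_singleton g hg hg1 v hS hw a).1, pow_succ, mul_comm]
  · rw [show 2 * a + 1 + 2 = 2 * (a + 1) + 1 by ring,
      (finsum_absNorm_eq_prime_pow_of_singleton g hg hg1 v hS hw (a + 1)).2,
      (finsum_absNorm_eq_prime_pow_of_singleton g hg hg1 v hS hw a).2, mul_zero]

end PrimePower

/-! ### The Hecke recursion for all `n ≥ 1` -/

section Hecke

/-- **`A(p) A(n) = A(pn)` for `p ∤ n`** (any unramified-or-not prime `p`: coprime multiplicativity).
[cite: Ribet1977Nebentypus, §3, Thm. (3.4) (LNM 601, p. 35)] -/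
theorem finsum_absNorm_eq_hecke_of_not_dvd (g : Ideal (𝓞 K) → R)
    (hg : ∀ A B : Ideal (𝓞 K), A ≠ ⊥ → B ≠ ⊥ → g (A * B) = g A * g B) (hg1 : g ⊤ = 1)
    (v : HeightOneSpectrum (𝓞 ℚ)) {n : ℕ} (hn : 0 < n) (hpn : ¬ Rat.HeightOneSpectrum.natGenerator v ∣ n) :
    (∑ᶠ I ∈ {I : Ideal (𝓞 K) | Ideal.absNorm I = Rat.HeightOneSpectrum.natGenerator v}, g I) *
        ∑ᶠ I ∈ {I : Ideal (𝓞 K) | Ideal.absNorm I = n}, g I =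
      ∑ᶠ I ∈ {I : Ideal (𝓞 K) | Ideal.absNorm I = Rat.HeightOneSpectrum.natGenerator v * n}, g I := by
  have hpp : (Rat.HeightOneSpectrum.natGenerator v).Prime := Rat.HeightOneSpectrum.prime_natGenerator v
  exact (finsum_absNorm_eq_mul_of_coprime g (map_mul_of_coprime_absNorm g hg hg1) hpp.pos hn
    (hpp.coprime_iff_not_dvd.mpr hpn)).symm

/-- **The Hecke recursion at a split prime**: `A(p) A(pn) = A(p²n) + g(𝔭) g(𝔭̄) A(n)` for `n ≥ 1`
(write `n = p^e m`, `p ∤ m`, and use `A(p) A(p^{e+1}) = A(p^{e+2}) + g(𝔭)g(𝔭̄) A(p^e)`).  With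
`g = ψ̃` and `g(𝔭) g(𝔭̄) = ψ̃((p)) = ε(p) p^{k-1}` this is "`g ∣ T_p = a_p g`" (Ribet 1977, Thm. (3.4))
on `q`-expansion coefficients. [cite: Ribet1977Nebentypus, §3, Thm. (3.4) (LNM 601, p. 35)] -/
theorem finsum_absNorm_eq_hecke_of_pair (g : Ideal (𝓞 K) → R)
    (hg : ∀ A B : Ideal (𝓞 K), A ≠ ⊥ → B ≠ ⊥ → g (A * B) = g A * g B) (hg1 : g ⊤ = 1)
    (v : HeightOneSpectrum (𝓞 ℚ)) {w₁ w₂ : HeightOneSpectrum (𝓞 K)} (hne : w₁ ≠ w₂)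
    (hS : {w : HeightOneSpectrum (𝓞 K) | w.asIdeal.under (𝓞 ℚ) = v.asIdeal} = {w₁, w₂})
    (h₁ : w₁.asIdeal.inertiaDeg (𝓞 ℚ) = 1) (h₂ : w₂.asIdeal.inertiaDeg (𝓞 ℚ) = 1) {n : ℕ} (hn : 0 < n) :
    (∑ᶠ I ∈ {I : Ideal (𝓞 K) | Ideal.absNorm I = Rat.HeightOneSpectrum.natGenerator v}, g I) *
        ∑ᶠ I ∈ {I : Ideal (𝓞 K) | Ideal.absNorm I = Rat.HeightOneSpectrum.natGenerator v * n}, g I =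
      (∑ᶠ I ∈ {I : Ideal (𝓞 K) |
          Ideal.absNorm I = Rat.HeightOneSpectrum.natGenerator v * (Rat.HeightOneSpectrum.natGenerator v * n)},
          g I) +
        g w₁.asIdeal * g w₂.asIdeal * ∑ᶠ I ∈ {I : Ideal (𝓞 K) | Ideal.absNorm I = n}, g I := by
  set p := Rat.HeightOneSpectrum.natGenerator v with hp
  have hpp : p.Prime := Rat.HeightOneSpectrum.prime_natGenerator v
  obtain ⟨e, m, hpm, rfl⟩ := Nat.exists_eq_pow_mul_and_not_dvd hn.ne' p hpp.ne_one
  have hm : 0 < m := Nat.pos_of_ne_zero fun h => by simp [h] at hn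
  have hg' := map_mul_of_coprime_absNorm g hg hg1
  have hcop : ∀ k : ℕ, (p ^ k).Coprime m := fun k =>
    Nat.Coprime.pow_left _ (hpp.coprime_iff_not_dvd.mpr hpm)
  have hsplit : ∀ k : ℕ, ∑ᶠ I ∈ {I : Ideal (𝓞 K) | Ideal.absNorm I = p ^ k * m}, g I =
      (∑ᶠ I ∈ {I : Ideal (𝓞 K) | Ideal.absNorm I = p ^ k}, g I) *
        ∑ᶠ I ∈ {I : Ideal (𝓞 K) | Ideal.absNorm I = m}, g I := fun k =>
    finsum_absNorm_eq_mul_of_coprime g hg' (pow_pos hpp.pos k) hm (hcop k)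
  have hrec := finsum_absNorm_eq_prime_pow_rec_of_pair g hg hg1 v hne hS h₁ h₂ e
  rw [show p * (p ^ e * m) = p ^ (e + 1) * m by ring,
    show p * (p ^ (e + 1) * m) = p ^ (e + 2) * m by ring, hsplit, hsplit, hsplit, hrec]
  ring

/-- **The Hecke recursion at an inert prime**: `A(p) = 0` and `A(p²n) = g(𝔭) A(n)` for `n ≥ 1`, so
`A(p) A(pn) = A(p²n) + c_p A(n)` with `c_p = -g(𝔭)` (`= -ψ̃((p)) = ε(p) p^{k-1}` for `g = ψ̃`:
Ribet's "`a_p = 0` if `φ(p) = -1`"). [cite: Ribet1977Nebentypus, §3, Thm. (3.4), Cor. (3.5) (LNM 601, p. 35)] -/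
theorem finsum_absNorm_eq_hecke_of_singleton (g : Ideal (𝓞 K) → R)
    (hg : ∀ A B : Ideal (𝓞 K), A ≠ ⊥ → B ≠ ⊥ → g (A * B) = g A * g B) (hg1 : g ⊤ = 1)
    (v : HeightOneSpectrum (𝓞 ℚ)) {w : HeightOneSpectrum (𝓞 K)}
    (hS : {w : HeightOneSpectrum (𝓞 K) | w.asIdeal.under (𝓞 ℚ) = v.asIdeal} = {w})
    (hw : w.asIdeal.inertiaDeg (𝓞 ℚ) = 2) {n : ℕ} (hn : 0 < n) :
    ∑ᶠ I ∈ {I : Ideal (𝓞 K) | Ideal.absNorm I = Rat.HeightOneSpectrum.natGenerator v}, g I = 0 ∧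
      ∑ᶠ I ∈ {I : Ideal (𝓞 K) |
          Ideal.absNorm I = Rat.HeightOneSpectrum.natGenerator v * (Rat.HeightOneSpectrum.natGenerator v * n)},
          g I =
        g w.asIdeal * ∑ᶠ I ∈ {I : Ideal (𝓞 K) | Ideal.absNorm I = n}, g I := by
  set p := Rat.HeightOneSpectrum.natGenerator v with hp
  have hpp : p.Prime := Rat.HeightOneSpectrum.prime_natGenerator v
  refine ⟨finsum_mem_setOf_absNorm_eq_of_singleton v hS hw g, ?_⟩
  obtain ⟨e, m, hpm, rfl⟩ := Nat.exists_eq_pow_mul_and_not_dvd hn.ne' p hpp.ne_one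
  have hm : 0 < m := Nat.pos_of_ne_zero fun h => by simp [h] at hn
  have hg' := map_mul_of_coprime_absNorm g hg hg1
  have hcop : ∀ k : ℕ, (p ^ k).Coprime m := fun k =>
    Nat.Coprime.pow_left _ (hpp.coprime_iff_not_dvd.mpr hpm)
  have hsplit : ∀ k : ℕ, ∑ᶠ I ∈ {I : Ideal (𝓞 K) | Ideal.absNorm I = p ^ k * m}, g I =
      (∑ᶠ I ∈ {I : Ideal (𝓞 K) | Ideal.absNorm I = p ^ k}, g I) *
        ∑ᶠ I ∈ {I : Ideal (𝓞 K) | Ideal.absNorm I = m}, g I := fun k =>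
    finsum_absNorm_eq_mul_of_coprime g hg' (pow_pos hpp.pos k) hm (hcop k)
  have hrec := finsum_absNorm_eq_prime_pow_rec_of_singleton g hg hg1 v hS hw e
  rw [show p * (p * (p ^ e * m)) = p ^ (e + 2) * m by ring, hsplit, hsplit, hrec, mul_assoc]

end Hecke

/-! ### The coefficients `a_n = ∑_{N𝔞 = n, (𝔞, 𝔣) = 1} ψ̃(𝔞)` of the CM form -/

section RayClass

open Literature.NumberTheory.LFunctions

/-- `rayClassCoeff 𝔪 c` (`= ψ̃(𝔞)` on nonzero ideals prime to `𝔪`, `0` otherwise) is completely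
multiplicative on nonzero ideals (`𝔞𝔟` is prime to `𝔪` iff both factors are). [folklore] -/
theorem rayClassCoeff_mul_of_ne_bot (𝔪 : Ideal (𝓞 K)) (c : HeightOneSpectrum (𝓞 K) → ℂ)
    {A B : Ideal (𝓞 K)} (hA : A ≠ ⊥) (hB : B ≠ ⊥) :
    rayClassCoeff 𝔪 c (A * B) = rayClassCoeff 𝔪 c A * rayClassCoeff 𝔪 c B := by
  classical
  have hAB : A * B ≠ ⊥ := Ideal.mul_eq_bot.not.mpr (not_or.mpr ⟨hA, hB⟩)
  by_cases hAc : IsCoprime A 𝔪 <;> by_cases hBc : IsCoprime B 𝔪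
  · have hc : IsCoprime (A * B) 𝔪 := hAc.mul_left hBc
    simp [rayClassCoeff, hA, hB, hAB, hAc, hBc, hc, idealPow_mul c hA hB]
  · have hc : ¬ IsCoprime (A * B) 𝔪 := fun h => hBc h.of_mul_left_right
    simp [rayClassCoeff, hBc, hc]
  · have hc : ¬ IsCoprime (A * B) 𝔪 := fun h => hAc h.of_mul_left_left
    simp [rayClassCoeff, hAc, hc]
  · have hc : ¬ IsCoprime (A * B) 𝔪 := fun h => hAc h.of_mul_left_left
    simp [rayClassCoeff, hAc, hc]

/-- `rayClassCoeff 𝔪 c (1) = 1`. [folklore] -/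
theorem rayClassCoeff_top (𝔪 : Ideal (𝓞 K)) (c : HeightOneSpectrum (𝓞 K) → ℂ) :
    rayClassCoeff 𝔪 c ⊤ = 1 := by
  classical
  have hcop : IsCoprime (⊤ : Ideal (𝓞 K)) 𝔪 := by
    rw [← Ideal.one_eq_top]; exact isCoprime_one_left
  simp [rayClassCoeff, hcop, idealPow_top]

/-- `rayClassCoeff 𝔪 c 𝔭_w = c(w)` for a prime `𝔭_w` prime to `𝔪`. [folklore] -/
theorem rayClassCoeff_asIdeal_of_isCoprime (𝔪 : Ideal (𝓞 K)) (c : HeightOneSpectrum (𝓞 K) → ℂ)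
    {w : HeightOneSpectrum (𝓞 K)} (hw : IsCoprime w.asIdeal 𝔪) :
    rayClassCoeff 𝔪 c w.asIdeal = c w := by
  classical
  simp [rayClassCoeff, w.ne_bot, hw, idealPow_asIdeal]

/-- **Hecke recursion for the CM coefficients at a split prime.**  Let `K` be a quadratic field,
`c` the values of a character on the places of `K` (meant: `c(w) = ψ(ϖ_w)`), `𝔪` an ideal (the
conductor), and `a_n = ∑_{N𝔞 = n} rayClassCoeff 𝔪 c 𝔞 = ∑_{N𝔞 = n, (𝔞,𝔪) = 1} ψ̃(𝔞)` the Dirichlet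
coefficients of `L(s, ψ)` (the `q`-expansion coefficients of Ribet's `g = ∑_{(𝔞,𝔪)=1} ψ(𝔞) q^{N𝔞}`).
At a place `v` of `ℚ` (prime `p`) that splits in `K` into `w₁ ≠ w₂`, both prime to `𝔪`:
`a_p a_{pn} = a_{p²n} + ψ̃((p)) a_n` for all `n ≥ 1` (and `a_p a_n = a_{pn}` for `p ∤ n`,
`finsum_absNorm_eq_hecke_of_not_dvd`) — with `ψ̃((p)) = ε(p) p^{k-1}` this is
`a_n(T_p g) = a_{pn} + ε(p)p^{k-1} a_{n/p} = a_p a_n`, i.e. "`g ∣ T_p = a_p g`".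
[cite: Ribet1977Nebentypus, §3, Thm. (3.4) (LNM 601, p. 35)] -/
theorem finsum_absNorm_eq_rayClassCoeff_hecke_of_pair (h2 : Module.finrank ℚ K = 2)
    (𝔪 : Ideal (𝓞 K)) (c : HeightOneSpectrum (𝓞 K) → ℂ) (v : HeightOneSpectrum (𝓞 ℚ))
    {w₁ w₂ : HeightOneSpectrum (𝓞 K)} (hne : w₁ ≠ w₂)
    (hS : {w : HeightOneSpectrum (𝓞 K) | w.asIdeal.under (𝓞 ℚ) = v.asIdeal} = {w₁, w₂})
    (h₁ : w₁.asIdeal.inertiaDeg (𝓞 ℚ) = 1) (h₂ : w₂.asIdeal.inertiaDeg (𝓞 ℚ) = 1)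
    (hc₁ : IsCoprime w₁.asIdeal 𝔪) (hc₂ : IsCoprime w₂.asIdeal 𝔪) {n : ℕ} (hn : 0 < n) :
    (∑ᶠ I ∈ {I : Ideal (𝓞 K) | Ideal.absNorm I = Rat.HeightOneSpectrum.natGenerator v},
        rayClassCoeff 𝔪 c I) *
        ∑ᶠ I ∈ {I : Ideal (𝓞 K) | Ideal.absNorm I = Rat.HeightOneSpectrum.natGenerator v * n},
          rayClassCoeff 𝔪 c I =
      (∑ᶠ I ∈ {I : Ideal (𝓞 K) |
          Ideal.absNorm I = Rat.HeightOneSpectrum.natGenerator v * (Rat.HeightOneSpectrum.natGenerator v * n)},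
          rayClassCoeff 𝔪 c I) +
        idealPow K c (Ideal.span {((Rat.HeightOneSpectrum.natGenerator v : ℕ) : 𝓞 K)}) *
          ∑ᶠ I ∈ {I : Ideal (𝓞 K) | Ideal.absNorm I = n}, rayClassCoeff 𝔪 c I := by
  rw [finsum_absNorm_eq_hecke_of_pair (rayClassCoeff 𝔪 c) (fun A B hA hB => rayClassCoeff_mul_of_ne_bot 𝔪 c hA hB)
      (rayClassCoeff_top 𝔪 c) v hne hS h₁ h₂ hn,
    rayClassCoeff_asIdeal_of_isCoprime 𝔪 c hc₁, rayClassCoeff_asIdeal_of_isCoprime 𝔪 c hc₂,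
    idealPow_span_natGenerator_of_pair h2 c v hne hS h₁ h₂]

/-- **Hecke recursion for the CM coefficients at an inert prime**: `a_p = 0` and
`a_{p²n} = ψ̃((p)) a_n` (`n ≥ 1`), i.e. `a_n(T_p g) = a_{pn} + ε(p) p^{k-1} a_{n/p} = 0 = a_p a_n`
with `ε(p) p^{k-1} = -ψ̃((p))` (Ribet: "`a_p = 0` if `φ(p) = -1`").
[cite: Ribet1977Nebentypus, §3, Thm. (3.4), Cor. (3.5) (LNM 601, p. 35)] -/
theorem finsum_absNorm_eq_rayClassCoeff_hecke_of_singleton (h2 : Module.finrank ℚ K = 2)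
    (𝔪 : Ideal (𝓞 K)) (c : HeightOneSpectrum (𝓞 K) → ℂ) (v : HeightOneSpectrum (𝓞 ℚ))
    {w : HeightOneSpectrum (𝓞 K)}
    (hS : {w : HeightOneSpectrum (𝓞 K) | w.asIdeal.under (𝓞 ℚ) = v.asIdeal} = {w})
    (hw : w.asIdeal.inertiaDeg (𝓞 ℚ) = 2) (hc : IsCoprime w.asIdeal 𝔪) {n : ℕ} (hn : 0 < n) :
    ∑ᶠ I ∈ {I : Ideal (𝓞 K) | Ideal.absNorm I = Rat.HeightOneSpectrum.natGenerator v},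
        rayClassCoeff 𝔪 c I = 0 ∧
      ∑ᶠ I ∈ {I : Ideal (𝓞 K) |
          Ideal.absNorm I = Rat.HeightOneSpectrum.natGenerator v * (Rat.HeightOneSpectrum.natGenerator v * n)},
          rayClassCoeff 𝔪 c I =
        idealPow K c (Ideal.span {((Rat.HeightOneSpectrum.natGenerator v : ℕ) : 𝓞 K)}) *
          ∑ᶠ I ∈ {I : Ideal (𝓞 K) | Ideal.absNorm I = n}, rayClassCoeff 𝔪 c I := by
  obtain ⟨h0, hrec⟩ := finsum_absNorm_eq_hecke_of_singleton (rayClassCoeff 𝔪 c)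
    (fun A B hA hB => rayClassCoeff_mul_of_ne_bot 𝔪 c hA hB) (rayClassCoeff_top 𝔪 c) v hS hw hn
  refine ⟨h0, ?_⟩
  rw [hrec, rayClassCoeff_asIdeal_of_isCoprime 𝔪 c hc, idealPow_span_natGenerator_of_singleton h2 c v hS hw]

end RayClass

end Literature.NumberTheory.EllipticCurves.ModularForms

end
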